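import Literature.NumberTheory.EllipticCurves.RootNumberTwistProofs
import Summits.BirchSwinnertonDyer.BirchSwinnertonDyer.Theorems.ManinLocalTwoThreeManinPrimeToAdditiveFiveLeHorocyclicBottomIff
import Summits.BirchSwinnertonDyer.BirchSwinnertonDyer.Theorems.ManinLocalTwoThreeManinPrimeToAdditiveFiveLeOrdinaryCornerNotBottomOfOrdinaryTwistLaws
import HarnessLib

/-!
# Route `ManinLocalTwoThree`, residual crux C5 `ManinPrimeToAdditiveFiveLe` (stmt-BirchSwinnertonDyer-22969),
# registered stub `stub_ord57` (stmt-27552), line «horocyclic-orientation»: **K18b″ `OrdinaryCornerDeepUnstarredNotBottom`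
# (stmt-27662) is EQUIVALENT, by name, to the existence of horocyclic witnesses at the deep unstarred corner — with
# NO congruence condition on `A`**

Width seat bsd-line-ml23-c5-p1-w3 (gen 3); sequel of `…NotBottomOfHorocyclic` (H57 ⟹ K18b″) and of the curve-free
dictionary `…HorocyclicBottomIff` (BOTTOM ⟺ all horocyclic differences vanish mod `p·Λ_f`). The line card
(«horocyclic-orientation», bsd-idea-8 g6) asserts «H57 EQUIVALENT on these rows to ¬BOTTOM (27662) by
`stub_notBottom_of_horocyclic57` and its (unfiled) converse». THIS FILE files the converse in its TRUE form:

`ordinaryCornerDeepUnstarredNotBottom_iff_horocyclicWitnesses` — **K18b″ ⟺ H57′**, where H57′ is the line's crux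
`OrdinaryCornerDeepUnstarredHorocyclic` with the clause `p ∣ A² − 1` DELETED (same rows, same binders: on
`(5; v₅Δ = 3)`, `(7; v₇Δ ∈ {2,4})`, `p² ∣ N`, `W[p]` reducible, `W ⊗ p*` additive, lattice-optimal datum, Serre–Tate-deep,
there are `A, C` with `N ∣ C > 0`, `gcd(A, C) = 1` and `Σ_{i≤k} (−1)^i C(k,i) {∞, A/C + i/p}_{f_W} ∉ p·Λ_{f_W}`).

So H57 as typed (`A ≡ ±1 (mod p)`) is H57′ plus a normalisation of the witness that the dictionary does NOT supply
(complex conjugation only gives `A ↦ −A`); the planners may either drop the clause from H57 (then H57 ≡ K18b″ by this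
file, and the line's «why easier» is exactly «one integral class instead of two lattices») or keep it and owe the
normalisation. (The instrument found `A ≡ ±1` witnesses on all 18 tested curves; that is evidence for H57, not for
the equivalence.)

Proof: (⟹) K18b″ at the Legendre character `χ_p` (quadratic, primitive for odd `p`:
`isQuadratic_quadraticChar_ringHomComp`, `isPrimitive_quadraticChar_ringHomComp`) says ¬BOTTOM(f_W, χ_p); the
dictionary turns this into a cusp `A/C`, `N ∣ C ≠ 0`, with a non-vanishing difference; `(A, C) ↦ (−A, −C)` makes `C > 0`.
(⟸) the quadratic primitive `χ` has the Legendre values (`dirichletCharacter_eq_quadraticChar_of_isQuadratic_of_isPrimitive`)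
and `g(χ) ≠ 0`; BOTTOM and the dictionary put every difference in `p·Λ_f`, contradicting the witness.

HONEST STATUS. An unconditional EQUIVALENCE between two OPEN statements; neither K18b″ nor H57/H57′ is proved; 27552,
C5, Manin's conjecture and BSD are not proved. No summit statement is proved by this seat.

References: [EdixhovenManin1991] §4 (case 1); [Shimura1971] Prop. 3.64; [MazurTateTeitelbaum1986Invent] §I.8; crux dir
`Cruxes/ManinPrimeToAdditiveFiveLe/Lines/horocyclic-orientation.md`.
-/

set_option autoImplicit false
-- the Theorems namespace of this sub repeats the summit name by design (D-0017 nested layout)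
set_option linter.dupNamespace false

noncomputable section

open scoped Classical NumberField

namespace Summit.BirchSwinnertonDyer.BirchSwinnertonDyer.Theorems

section Equivalence

open WeierstrassCurve IsDedekindDomain NumberField Literature.NumberTheory.EllipticCurves
  Literature.NumberTheory.EllipticCurves.ModularForms

/-- **K18b″ (stmt-27662) ⟺ horocyclic witnesses without congruence condition (H57′).** On the rows of K18b″
(`(5; v₅Δ = 3)`, `(7; v₇Δ ∈ {2, 4})`, `p² ∣ N`, `W[p]` reducible, `W ⊗ p*` additive, lattice-optimal datum `D`,
Serre–Tate-deep): «¬BOTTOM(f_W, χ) for every quadratic primitive `χ` mod `p`» holds for all such `(W, p, D)` iff for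
all such `(W, p, D)` there are `A, C ∈ ℤ` with `N ∣ C > 0`, `gcd(A, C) = 1` and
`Σ_{i≤k} (−1)^i C(k,i) {∞, A/C + i/p}_{f_W} ∉ p·Λ_{f_W}`, `k = (p−1)/2`. Both directions through the curve-free
dictionary `horocyclic_bottom_iff_forall_horocyclicDifference_mem` at the Legendre character.
[cite: EdixhovenManin1991, §4] [cite: Shimura1971, Prop. 3.64] [cite: MazurTateTeitelbaum1986Invent, §I.8] -/
theorem ordinaryCornerDeepUnstarredNotBottom_iff_horocyclicWitnesses :
    Summit.BirchSwinnertonDyer.BirchSwinnertonDyer.Theses.TwistFamilyManinDescent.OrdinaryCornerDeepUnstarredNotBottom ↔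
    ∀ (W : WeierstrassCurve ℚ) [W.IsElliptic] [W.IsGloballyMinimal] (p : ℕ) [Fact p.Prime]
      [NeZero (W.conductorNorm ℤ)] (D : ModularParametrizationData W (W.conductorNorm ℤ))
      (_hsq : p ^ 2 ∣ W.conductorNorm ℤ),
      ((p = 5 ∧ padicValInt 5 W.minimalDiscriminantInt = 3) ∨
        (p = 7 ∧ padicValInt 7 W.minimalDiscriminantInt ∈ ({2, 4} : Finset ℕ))) →
      ¬ W.HasIrreducibleModPGaloisRep p →
      ¬ ((W.quadraticTwist (((-1 : ℤ) ^ (p / 2) * p : ℤ) : ℚ)).HasGoodReductionAt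
            ((Rat.HeightOneSpectrum.primesEquiv (R := ℤ)).symm ⟨p, Fact.out⟩) ∨
         (W.quadraticTwist (((-1 : ℤ) ^ (p / 2) * p : ℤ) : ℚ)).HasMultiplicativeReductionAt
            ((Rat.HeightOneSpectrum.primesEquiv (R := ℤ)).symm ⟨p, Fact.out⟩)) →
      (∀ z ∈ D.L.lattice, ∃ w ∈ periodLattice D.f, z = D.c * w) →
      ((p = 5 → (3 : ℤ) ≤ padicValRat 5 (W.j - 1728)) ∧ (p = 7 → (4 : ℤ) ≤ padicValRat 7 W.j)) →
      ∃ (A C : ℤ), (W.conductorNorm ℤ : ℤ) ∣ C ∧ 0 < C ∧ IsCoprime A C ∧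
        ¬ ∃ y ∈ periodLattice D.f, (∑ i ∈ Finset.range ((p - 1) / 2 + 1),
          ((((-1 : ℤ) ^ i * (((p - 1) / 2).choose i : ℕ)) : ℤ) : ℂ) *
            modularSymbol D.f ((A : ℚ) / (C : ℚ) + (i : ℚ) / (p : ℚ))) = (p : ℂ) * y := by
  constructor
  · -- (⟹): K18b″ at the Legendre character, then the dictionary
    intro hK W _ _ p _ _ D hsq hrows hred hadd hopt hdeep
    have hp2 : p ≠ 2 := by
      rcases hrows with ⟨rfl, _⟩ | ⟨rfl, _⟩ <;> decide
    set χ₀ : DirichletCharacter ℂ p := (quadraticChar (ZMod p)).ringHomComp (Int.castRingHom ℂ) with hχ₀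
    have hq : χ₀.IsQuadratic := isQuadratic_quadraticChar_ringHomComp p
    have hprim : χ₀.IsPrimitive := isPrimitive_quadraticChar_ringHomComp p hp2
    have hχL : ∀ u : ZMod p, χ₀ u = ((quadraticChar (ZMod p) u : ℤ) : ℂ) := fun u ↦ by
      rw [hχ₀, MulChar.ringHomComp_apply, eq_intCast]
    have hnot := hK W p D hsq hrows hred hadd hopt hdeep χ₀ hq hprim
    rw [horocyclic_bottom_iff_forall_horocyclicDifference_mem D.f hp2 (dvd_refl _) hsq hq hχL
      (gaussSum_stdAddChar_ne_zero_of_isPrimitive hprim)] at hnot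
    push Not at hnot
    obtain ⟨A, C, hNC, hC, hAC, hne⟩ := hnot
    -- normalise the sign of `C`
    rcases lt_or_gt_of_ne hC with hlt | hgt
    · refine ⟨-A, -C, (dvd_neg).mpr hNC, by omega, hAC.neg_neg, ?_⟩
      rintro ⟨y, hy, e⟩
      refine hne y hy ?_
      rw [← e]
      refine Finset.sum_congr rfl fun i _ ↦ ?_
      push_cast
      rw [neg_div_neg_eq]
    · refine ⟨A, C, hNC, hgt, hAC, ?_⟩
      rintro ⟨y, hy, e⟩
      exact hne y hy e
  · -- (⟸): a witness forbids BOTTOM for the quadratic primitive character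
    intro H W _ _ p _ _ D hsq hrows hred hadd hopt hdeep χ hχ hprim hbot
    obtain ⟨A, C, hNC, hC0, hAC, hnot⟩ := H W p D hsq hrows hred hadd hopt hdeep
    have hp2 : p ≠ 2 := by
      rcases hrows with ⟨rfl, _⟩ | ⟨rfl, _⟩ <;> decide
    have hχL : ∀ u : ZMod p, χ u = ((quadraticChar (ZMod p) u : ℤ) : ℂ) := fun u ↦ by
      rw [dirichletCharacter_eq_quadraticChar_of_isQuadratic_of_isPrimitive hp2 χ hχ hprim,
        MulChar.ringHomComp_apply, eq_intCast]
    exact hnot ((horocyclic_bottom_iff_forall_horocyclicDifference_mem D.f hp2 (dvd_refl _) hsq hχ hχL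
      (gaussSum_stdAddChar_ne_zero_of_isPrimitive hprim)).mp hbot A C hNC hC0.ne' hAC)

end Equivalence

end Summit.BirchSwinnertonDyer.BirchSwinnertonDyer.Theorems

end
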